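import Literature.Analysis.FluidPDE.NewtonPotential
import HarnessLib

/-!
# Kernel norms for the local Biot–Savart representation at a Whitney scale

Analysis/FluidPDE support file for the discharge of the named fact
`Literature.Analysis.FluidPDE.tao2011_nonlinearEstimate` (Tao 2011, §10, proof of Thm. 10.1,
the estimate of the nonlinear term `Y₆`, arXiv:1108.1165 pp. 31–33). Tao writes, on each Whitney
ball `B(xᵢ, rᵢ)`, the local Biot–Savart law `u = O(Δ⁻¹∇(ψᵢω)) + v` with `v` harmonic and
controls `∇v` by the mean value property. In the tree this is realised with the localised
Newtonian kernel `Γ₀ = θΓ` (`newtonNear r₀ r₁`) and the smooth compactly supported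
`λ = Δ((1-θ)Γ)` (`newtonFarLaplacian r₀ r₁`) of `FluidPDE/NewtonKernel`, `FluidPDE/NewtonPotential`
(`∫ Γ₀ Δφ = φ(0) - ∫ λ φ`). This file records the two size facts about these kernels that the
`Y₆` estimate consumes, with their behaviour under the dilation `(r₀, r₁) ↦ (c r₀, c r₁)`:

* `Γ₀ ∈ L²(ℝ³)` (`|Γ₀(z)| ≤ (4π|z|)⁻¹`, and `|z|⁻²` is integrable near `0` in dimension `3`),
  with `∫ (Γ₀^{cr₀,cr₁})² = c ∫ (Γ₀^{r₀,r₁})²` (`integral_sq_newtonNear_scale`);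
* `Dλ` is continuous with compact support, `Dλ^{cr₀,cr₁}(z) = c⁻⁴ Dλ^{r₀,r₁}(c⁻¹z)`, hence
  `∫ ‖Dλ^{cr₀,cr₁}‖ = c⁻¹ ∫ ‖Dλ^{r₀,r₁}‖` and `∫ ‖Dλ^{cr₀,cr₁}‖² = c⁻⁵ ∫ ‖Dλ^{r₀,r₁}‖²`.

These give Tao's two bounds for the harmonic remainder, `‖∇v‖_{L^∞(Bᵢ)} ≲ rᵢ⁻¹ ‖u‖_{L^∞}` and
`≲ rᵢ^{-5/2} ‖u‖_{L²}` (p. 32), in kernel form.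

## References

* T. Tao, *Localisation and compactness properties of the Navier–Stokes global regularity
  problem*, Anal. PDE 6 (2013) 25–107 = arXiv:1108.1165, §10, proof of Thm. 10.1, p. 32.
* D. Gilbarg, N. S. Trudinger, *Elliptic partial differential equations of second order*
  (2001), (2.12)–(2.17).
-/

noncomputable section

open MeasureTheory Set Filter Metric Topology Function Real
open scoped RealInnerProductSpace ContDiff

namespace Literature.Analysis.FluidPDE

variable {r₀ r₁ : ℝ}

/-! ### `Γ₀ ∈ L²` and its scaling -/

/-- The square of the localised Newtonian kernel is measurable. [folklore] -/
theorem measurable_sq_newtonNear (r₀ r₁ : ℝ) : Measurable fun z : EuclideanSpace ℝ (Fin 3) => newtonNear r₀ r₁ z ^ 2 :=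
  (measurable_newtonNear r₀ r₁).pow_const 2

/-- **`Γ₀ ∈ L²(EuclideanSpace ℝ (Fin 3))`**: `Γ₀(z)² ≤ (4π)⁻²|z|⁻²` with `2 < 3 = dim`, and compact support. [folklore] -/
theorem integrable_sq_newtonNear (h₀ : 0 ≤ r₀) (h₁ : r₀ < r₁) :
    Integrable fun z : EuclideanSpace ℝ (Fin 3) => newtonNear r₀ r₁ z ^ 2 := by
  have hsupp : support (fun z : EuclideanSpace ℝ (Fin 3) => newtonNear r₀ r₁ z ^ 2) ⊆ ball (0 : EuclideanSpace ℝ (Fin 3)) (r₁ + 1) := by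
    intro z hz
    rw [mem_ball_zero_iff]
    by_contra h
    apply hz
    simp only [newtonNear_eq_zero h₀ h₁ (by linarith [not_lt.1 h]), ne_eq, OfNat.ofNat_ne_zero,
      not_false_eq_true, zero_pow]
  rw [← integrableOn_iff_integrable_of_support_subset hsupp]
  refine integrableOn_ball_of_norm_le_rpow (by rw [finrank_euclideanSpace_fin]; norm_num)
    (C := ((4 * π)⁻¹) ^ 2) (α := 2) (by rw [finrank_euclideanSpace_fin]; norm_num)
    (Eventually.of_forall fun z => ?_) (measurable_sq_newtonNear r₀ r₁).aestronglyMeasurable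
  rw [Real.norm_eq_abs, abs_pow, Real.rpow_neg (norm_nonneg _), Real.rpow_two, ← inv_pow,
    ← mul_pow]
  refine pow_le_pow_left₀ (abs_nonneg _) ?_ 2
  calc |newtonNear r₀ r₁ z| ≤ (4 * π * ‖z‖)⁻¹ := abs_newtonNear_le r₀ r₁ z
    _ = (4 * π)⁻¹ * ‖z‖⁻¹ := by rw [mul_inv]

/-- **Scaling of `∫ Γ₀²`**: `∫ (Γ₀^{cr₀,cr₁})² = c ∫ (Γ₀^{r₀,r₁})²`. [folklore] -/
theorem integral_sq_newtonNear_scale {c : ℝ} (hc : 0 < c) (r₀ r₁ : ℝ) :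
    ∫ z, newtonNear (c * r₀) (c * r₁) z ^ 2 = c * ∫ w, newtonNear r₀ r₁ w ^ 2 := by
  have h := Measure.integral_comp_inv_smul_of_nonneg volume
    (fun w : EuclideanSpace ℝ (Fin 3) => newtonNear r₀ r₁ w ^ 2) hc.le
  simp only [finrank_euclideanSpace_fin] at h
  simp_rw [newtonNear_scale hc, mul_pow, integral_const_mul, h, smul_eq_mul, ← mul_assoc]
  rw [show (c⁻¹) ^ 2 * c ^ 3 = c by field_simp]

/-- `∫ (Γ₀^{r, 2r})² = r ∫ (Γ₀^{1,2})²` for `r > 0`. [folklore] -/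
theorem integral_sq_newtonNear_two_mul {r : ℝ} (hr : 0 < r) :
    ∫ z, newtonNear r (2 * r) z ^ 2 = r * ∫ w, newtonNear 1 2 w ^ 2 := by
  have := integral_sq_newtonNear_scale hr 1 2
  rwa [mul_one, mul_comm r 2] at this

/-- `0 ≤ ∫ Γ₀²`. [folklore] -/
theorem integral_sq_newtonNear_nonneg (r₀ r₁ : ℝ) : 0 ≤ ∫ z : EuclideanSpace ℝ (Fin 3), newtonNear r₀ r₁ z ^ 2 :=
  integral_nonneg fun _ => sq_nonneg _

/-- `Γ₀ ∈ L²` in Mathlib's `MemLp` vocabulary. [folklore] -/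
theorem memLp_two_newtonNear (h₀ : 0 ≤ r₀) (h₁ : r₀ < r₁) :
    MemLp (newtonNear r₀ r₁) 2 (volume : Measure (EuclideanSpace ℝ (Fin 3))) :=
  (memLp_two_iff_integrable_sq (measurable_newtonNear r₀ r₁).aestronglyMeasurable).2
    (integrable_sq_newtonNear h₀ h₁)

/-! ### `Dλ`: continuity, support, scaling -/

/-- `Dλ` is continuous. [folklore] -/
theorem continuous_fderiv_newtonFarLaplacian (h₀ : 0 < r₀) (h₁ : r₀ < r₁) :
    Continuous (fderiv ℝ (newtonFarLaplacian r₀ r₁)) :=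
  (contDiff_newtonFarLaplacian h₀ h₁ (n := 1)).continuous_fderiv one_ne_zero

/-- `Dλ` has compact support. [folklore] -/
theorem hasCompactSupport_fderiv_newtonFarLaplacian (h₀ : 0 < r₀) (h₁ : r₀ < r₁) :
    HasCompactSupport (fderiv ℝ (newtonFarLaplacian r₀ r₁)) :=
  (hasCompactSupport_newtonFarLaplacian h₀.le h₁).fderiv (𝕜 := ℝ)

/-- `Dλ^{r₀,r₁}(z) = 0` for `|z| > r₁`. [folklore] -/
theorem fderiv_newtonFarLaplacian_eq_zero_of_gt (h₀ : 0 ≤ r₀) (h₁ : r₀ < r₁) {z : EuclideanSpace ℝ (Fin 3)}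
    (hz : r₁ < ‖z‖) : fderiv ℝ (newtonFarLaplacian r₀ r₁) z = 0 := by
  have hev : newtonFarLaplacian r₀ r₁ =ᶠ[𝓝 z] fun _ => 0 := by
    have ho : IsOpen {w : EuclideanSpace ℝ (Fin 3) | r₁ < ‖w‖} := isOpen_lt continuous_const continuous_norm
    filter_upwards [ho.mem_nhds hz] with w hw
    exact newtonFarLaplacian_eq_zero_of_gt h₀ h₁ hw
  rw [hev.fderiv_eq, fderiv_const_apply]

/-- `‖Dλ‖` is integrable. [folklore] -/
theorem integrable_norm_fderiv_newtonFarLaplacian (h₀ : 0 < r₀) (h₁ : r₀ < r₁) :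
    Integrable fun z : EuclideanSpace ℝ (Fin 3) => ‖fderiv ℝ (newtonFarLaplacian r₀ r₁) z‖ :=
  ((continuous_fderiv_newtonFarLaplacian h₀ h₁).norm).integrable_of_hasCompactSupport
    (hasCompactSupport_fderiv_newtonFarLaplacian h₀ h₁).norm

/-- `‖Dλ‖²` is integrable. [folklore] -/
theorem integrable_sq_norm_fderiv_newtonFarLaplacian (h₀ : 0 < r₀) (h₁ : r₀ < r₁) :
    Integrable fun z : EuclideanSpace ℝ (Fin 3) => ‖fderiv ℝ (newtonFarLaplacian r₀ r₁) z‖ ^ 2 := by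
  have hc : HasCompactSupport fun z : EuclideanSpace ℝ (Fin 3) => ‖fderiv ℝ (newtonFarLaplacian r₀ r₁) z‖ ^ 2 := by
    have := (hasCompactSupport_fderiv_newtonFarLaplacian h₀ h₁).norm.mul_right
      (f' := fun z : EuclideanSpace ℝ (Fin 3) => ‖fderiv ℝ (newtonFarLaplacian r₀ r₁) z‖)
    simpa only [sq, Pi.mul_def] using this
  exact ((continuous_fderiv_newtonFarLaplacian h₀ h₁).norm.pow 2).integrable_of_hasCompactSupport hc

/-- **Scaling of `Dλ`**: `Dλ^{cr₀,cr₁}(z) = c⁻⁴ Dλ^{r₀,r₁}(c⁻¹ z)`. [folklore] -/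
theorem fderiv_newtonFarLaplacian_scale {c : ℝ} (hc : 0 < c) (r₀ r₁ : ℝ) (z : EuclideanSpace ℝ (Fin 3)) :
    fderiv ℝ (newtonFarLaplacian (c * r₀) (c * r₁)) z =
      c⁻¹ ^ 4 • fderiv ℝ (newtonFarLaplacian r₀ r₁) (c⁻¹ • z) := by
  have hfun : newtonFarLaplacian (c * r₀) (c * r₁) =
      fun w : EuclideanSpace ℝ (Fin 3) => (c⁻¹ ^ 3) • newtonFarLaplacian r₀ r₁ (c⁻¹ • w) := by
    funext w
    rw [newtonFarLaplacian_scale hc, smul_eq_mul]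
  rw [hfun, fderiv_const_smul_comp_smul _ _ (inv_ne_zero hc.ne')]
  simp only
  rw [show c⁻¹ ^ 3 * c⁻¹ = c⁻¹ ^ 4 by ring]

/-- `‖Dλ^{cr₀,cr₁}(z)‖ = c⁻⁴ ‖Dλ^{r₀,r₁}(c⁻¹ z)‖`. [folklore] -/
theorem norm_fderiv_newtonFarLaplacian_scale {c : ℝ} (hc : 0 < c) (r₀ r₁ : ℝ) (z : EuclideanSpace ℝ (Fin 3)) :
    ‖fderiv ℝ (newtonFarLaplacian (c * r₀) (c * r₁)) z‖ =
      c⁻¹ ^ 4 * ‖fderiv ℝ (newtonFarLaplacian r₀ r₁) (c⁻¹ • z)‖ := by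
  rw [fderiv_newtonFarLaplacian_scale hc, norm_smul, norm_pow, norm_inv, Real.norm_eq_abs,
    abs_of_pos hc]

/-- **Scaling of `∫ ‖Dλ‖`**: `∫ ‖Dλ^{cr₀,cr₁}‖ = c⁻¹ ∫ ‖Dλ^{r₀,r₁}‖`. [folklore] -/
theorem integral_norm_fderiv_newtonFarLaplacian_scale {c : ℝ} (hc : 0 < c) (r₀ r₁ : ℝ) :
    ∫ z, ‖fderiv ℝ (newtonFarLaplacian (c * r₀) (c * r₁)) z‖ =
      c⁻¹ * ∫ w, ‖fderiv ℝ (newtonFarLaplacian r₀ r₁) w‖ := by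
  have h := Measure.integral_comp_inv_smul_of_nonneg volume
    (fun w : EuclideanSpace ℝ (Fin 3) => ‖fderiv ℝ (newtonFarLaplacian r₀ r₁) w‖) hc.le
  simp only [finrank_euclideanSpace_fin] at h
  simp_rw [norm_fderiv_newtonFarLaplacian_scale hc, integral_const_mul, h, smul_eq_mul,
    ← mul_assoc]
  rw [show c⁻¹ ^ 4 * c ^ 3 = c⁻¹ by field_simp]

/-- **Scaling of `∫ ‖Dλ‖²`**: `∫ ‖Dλ^{cr₀,cr₁}‖² = c⁻⁵ ∫ ‖Dλ^{r₀,r₁}‖²`. [folklore] -/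
theorem integral_sq_norm_fderiv_newtonFarLaplacian_scale {c : ℝ} (hc : 0 < c) (r₀ r₁ : ℝ) :
    ∫ z, ‖fderiv ℝ (newtonFarLaplacian (c * r₀) (c * r₁)) z‖ ^ 2 =
      c⁻¹ ^ 5 * ∫ w, ‖fderiv ℝ (newtonFarLaplacian r₀ r₁) w‖ ^ 2 := by
  have h := Measure.integral_comp_inv_smul_of_nonneg volume
    (fun w : EuclideanSpace ℝ (Fin 3) => ‖fderiv ℝ (newtonFarLaplacian r₀ r₁) w‖ ^ 2) hc.le
  simp only [finrank_euclideanSpace_fin] at h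
  simp_rw [norm_fderiv_newtonFarLaplacian_scale hc, mul_pow, integral_const_mul, h, smul_eq_mul,
    ← mul_assoc]
  rw [show (c⁻¹ ^ 4) ^ 2 * c ^ 3 = c⁻¹ ^ 5 by field_simp]

/-- `∫ ‖Dλ^{r,2r}‖ = r⁻¹ ∫ ‖Dλ^{1,2}‖` for `r > 0`. [folklore] -/
theorem integral_norm_fderiv_newtonFarLaplacian_two_mul {r : ℝ} (hr : 0 < r) :
    ∫ z, ‖fderiv ℝ (newtonFarLaplacian r (2 * r)) z‖ =
      r⁻¹ * ∫ w, ‖fderiv ℝ (newtonFarLaplacian 1 2) w‖ := by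
  have := integral_norm_fderiv_newtonFarLaplacian_scale hr 1 2
  rwa [mul_one, mul_comm r 2] at this

/-- `∫ ‖Dλ^{r,2r}‖² = r⁻⁵ ∫ ‖Dλ^{1,2}‖²` for `r > 0`. [folklore] -/
theorem integral_sq_norm_fderiv_newtonFarLaplacian_two_mul {r : ℝ} (hr : 0 < r) :
    ∫ z, ‖fderiv ℝ (newtonFarLaplacian r (2 * r)) z‖ ^ 2 =
      r⁻¹ ^ 5 * ∫ w, ‖fderiv ℝ (newtonFarLaplacian 1 2) w‖ ^ 2 := by
  have := integral_sq_norm_fderiv_newtonFarLaplacian_scale hr 1 2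
  rwa [mul_one, mul_comm r 2] at this

/-- `0 ≤ ∫ ‖Dλ‖`. [folklore] -/
theorem integral_norm_fderiv_newtonFarLaplacian_nonneg (r₀ r₁ : ℝ) :
    0 ≤ ∫ z : EuclideanSpace ℝ (Fin 3), ‖fderiv ℝ (newtonFarLaplacian r₀ r₁) z‖ :=
  integral_nonneg fun _ => norm_nonneg _

/-- `0 ≤ ∫ ‖Dλ‖²`. [folklore] -/
theorem integral_sq_norm_fderiv_newtonFarLaplacian_nonneg (r₀ r₁ : ℝ) :
    0 ≤ ∫ z : EuclideanSpace ℝ (Fin 3), ‖fderiv ℝ (newtonFarLaplacian r₀ r₁) z‖ ^ 2 :=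
  integral_nonneg fun _ => sq_nonneg _

end Literature.Analysis.FluidPDE

end
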